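import Summits.ResolutionOfSingularities.KangarooAtlas.MizutaniProfileTransfer
import Mathlib.Algebra.MvPolynomial.Equiv
import Mathlib.Algebra.Polynomial.Roots
import HarnessLib

/-!
# Mizutani's conjecture `m(e) = 2p^e − 1` — the polynomial tower model, IV: torus degeneration (Theorem D)

Cell topic `Summits/ResolutionOfSingularities/KangarooAtlas` (pub-rosobs); namespace
`Summit.ResolutionOfSingularities.KangarooAtlas.Mizutani`.  Continuation of
`MizutaniProfileTransfer` (MIZUTANI-PROOF-g59 §5, THEOREM D).  In-house chain, AI-written; not a
resolution theorem.

THEOREM D (torus degeneration, semicontinuity of the profile): for weights `w ≥ 0` and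
`λ ∈ F^×` the torus `θ_λ` preserves profiles; the one-parameter family
`λ^{-m₀} (θ_λ ⊗ θ_λ) ω = ω₀ + λ ρ(λ)` degenerates `ω` to its initial form `ω₀ = in_w ω`, and a
minor of the HS matrix that is non-zero at `λ = 0` is a non-zero polynomial in `λ`, hence non-zero
at some `λ₀ ≠ 0` of the INFINITE field `F`; so `σ_n(ω) ≥ σ_n(in_w ω)`.

Implementation: the parameter `λ` is an extra UNPAIRED coefficient variable — the model
`(ι, Option κ, F)` with pairing `e⁺ = some ∘ e` and `Λ = a_none` — so that the family is ONE
element `Ω` of a model ring and "`λ ↦ λ₀`" is the compatible coefficient map `evalAt λ₀`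
(part III).  The theorem is stated for any `Ω'` with `θ_Λ(ω) = Λ^{m₀} · Ω'` and `Ω'|_{Λ=0} = ω₀`
(`profile_le_of_degeneration`); part V constructs `Ω'` for the vertex situation of Cor. D‴.

References: [Mizutani1973HironakaGroupSchemes] (Remark 2.10); [Oda1983HironakaGroupSchemeII]
(§1 p. 1166); [EGAIV4] Thm. 16.11.2.
-/

open MvPolynomial Literature.AlgebraicGeometry.Resolution

namespace Summit.ResolutionOfSingularities.KangarooAtlas.Mizutani

section OptionModel

variable {ι κ F : Type*} [CommRing F] (e : ι → κ)

/-- The pairing of the extended model `(ι, Option κ)`: `t_i` is paired with `a_{some (e i)}`; the new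
variable `Λ = a_none` is unpaired. [cite: Mizutani1973HironakaGroupSchemes, Remark 2.10 (in-house proof, §5 Thm D: the parameter λ)] -/
def ePlus : ι → Option κ := fun i => some (e i)

/-- The extended pairing is injective. [folklore] -/
theorem ePlus_injective (he : Function.Injective e) : Function.Injective (ePlus e) :=
  fun _ _ h => he (Option.some_injective _ h)

/-- Weights extended by `w(Λ) = 0`. [cite: Mizutani1973HironakaGroupSchemes, Remark 2.10 (in-house proof, §5 Thm D)] -/
def wPlus (w : κ → ℕ) : Option κ → ℕ := fun o => o.elim 0 w

/-- `w(Λ) = 0`. [folklore] -/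
@[simp] theorem wPlus_none (w : κ → ℕ) : wPlus w none = 0 := rfl
/-- `w⁺(some k) = w k`. [folklore] -/
@[simp] theorem wPlus_some (w : κ → ℕ) (k : κ) : wPlus w (some k) = w k := rfl

/-- The inclusion of coefficients `F[a_κ] ⊂ F[a_κ, Λ]`. [cite: Mizutani1973HironakaGroupSchemes, Remark 2.10 (in-house proof, §5 Thm D)] -/
noncomputable def incl : MvPolynomial κ F →+* MvPolynomial (Option κ) F :=
  eval₂Hom (C.comp (RingHom.id F)) fun k => X (some k)

/-- The specialisation `Λ ↦ c` (`c ∈ F`), `a_k ↦ a_k`. [cite: Mizutani1973HironakaGroupSchemes, Remark 2.10 (in-house proof, §5 Thm D: λ = λ₀)] -/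
noncomputable def evalAt (c : F) : MvPolynomial (Option κ) F →+* MvPolynomial κ F :=
  eval₂Hom (C.comp (RingHom.id F)) fun o => o.elim (C c) X

/-- `incl` fixes constants. [folklore] -/
@[simp] theorem incl_C (a : F) : incl (κ := κ) (C a) = C a := by simp [incl]
/-- `incl (a_k) = a_{some k}`. [folklore] -/
@[simp] theorem incl_X (k : κ) : incl (F := F) (X k) = X (some k) := by simp [incl]
/-- `evalAt` fixes constants. [folklore] -/
@[simp] theorem evalAt_C (c a : F) : evalAt (κ := κ) c (C a) = C a := by simp [evalAt]
/-- `evalAt c (Λ) = c`. [folklore] -/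
@[simp] theorem evalAt_X_none (c : F) : evalAt (κ := κ) c (X none) = C c := by simp [evalAt]
/-- `evalAt c (a_{some k}) = a_k`. [folklore] -/
@[simp] theorem evalAt_X_some (c : F) (k : κ) : evalAt c (X (some k) : MvPolynomial (Option κ) F) = X k := by
  simp [evalAt]

/-- `incl` is the renaming along `some`. [folklore] -/
theorem incl_eq_rename : incl (κ := κ) (F := F) = (rename some : MvPolynomial κ F →ₐ[F] _).toRingHom := by
  refine MvPolynomial.ringHom_ext (fun a => ?_) (fun k => ?_)
  · simp
  · simp

/-- `incl` is injective. [folklore] -/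
theorem incl_injective : Function.Injective (incl (κ := κ) (F := F)) := by
  rw [incl_eq_rename]
  exact rename_injective some (Option.some_injective _)

/-- `Λ ↦ c` after the inclusion is the identity. [folklore] -/
theorem evalAt_comp_incl (c : F) : (evalAt c).comp (incl (κ := κ) (F := F)) = RingHom.id _ := by
  refine MvPolynomial.ringHom_ext (fun a => ?_) (fun k => ?_)
  · simp
  · simp

/-- `evalAt c ∘ incl = id`, applied. [folklore] -/
@[simp] theorem evalAt_incl (c : F) (x : MvPolynomial κ F) : evalAt c (incl x) = x := by
  rw [← RingHom.comp_apply, evalAt_comp_incl, RingHom.id_apply]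

variable [Fintype ι] [DecidableEq κ]

/-- `incl` is a compatible coefficient map `(κ, e) → (Option κ, e⁺)`. [cite: EGAIV4, Thm. 16.11.2 (functoriality)] -/
theorem compat_incl (he : Function.Injective e) :
    (dtaylorCoeff (ι := ι) (ePlus e)).comp (incl (κ := κ) (F := F)) =
      (MvPolynomial.map (MvPolynomial.map incl)).comp (dtaylorCoeff e) := by
  unfold incl
  refine compat_of_generators e (ePlus e) he (ePlus_injective e he) (RingHom.id F) _ (fun _ => 0)
    (fun i => by simp [ePlus]) (fun k hk => ?_)
  rw [supported_eq_adjoin_X]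
  refine Algebra.subset_adjoin ⟨some k, ?_, rfl⟩
  rintro ⟨i, hi⟩
  exact hk i (Option.some_injective _ hi)

/-- `evalAt c` is a compatible coefficient map `(Option κ, e⁺) → (κ, e)`. [cite: EGAIV4, Thm. 16.11.2 (functoriality)] -/
theorem compat_evalAt (he : Function.Injective e) (c : F) :
    (dtaylorCoeff (ι := ι) e).comp (evalAt (κ := κ) c) =
      (MvPolynomial.map (MvPolynomial.map (evalAt c))).comp (dtaylorCoeff (ePlus e)) := by
  unfold evalAt
  refine compat_of_generators (ePlus e) e (ePlus_injective e he) he (RingHom.id F) _ (fun _ => 0)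
    (fun i => by simp [ePlus]) (fun o ho => ?_)
  cases o with
  | none =>
    simp only [Option.elim_none]
    rw [← algebraMap_eq]
    exact Subalgebra.algebraMap_mem _ c
  | some k =>
    simp only [Option.elim_some]
    rw [supported_eq_adjoin_X]
    refine Algebra.subset_adjoin ⟨k, ?_, rfl⟩
    rintro ⟨i, hi⟩
    exact ho i (by rw [ePlus, hi])

/-- The parameter `Λ` is not seen by the pairing `e⁺`. [cite: EGAIV4, Thm. 16.11.2] -/
theorem dtaylorCoeff_Lambda_pow (m : ℕ) :
    dtaylorCoeff (ι := ι) (ePlus e) ((X none : MvPolynomial (Option κ) F) ^ m) =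
      C (C ((X none : MvPolynomial (Option κ) F) ^ m)) := by
  rw [map_pow, dtaylorCoeff_X, uOf_of_notMem (ePlus e) none (fun i h => Option.some_ne_none _ h),
    add_zero, map_pow, map_pow]

end OptionModel

/-! ## Avoiding finitely many values of the parameter -/

section Avoid

variable {κ F : Type*} [Field F]

/-- `evalAt c` through `optionEquivLeft`: `m|_{Λ = c}` is the evaluation at `C c` of `m` read as a
polynomial in `Λ` over `F[a_κ]`. [folklore] -/
theorem evalAt_eq_eval_optionEquivLeft (c : F) (m : MvPolynomial (Option κ) F) :
    evalAt c m = Polynomial.eval (C c) (optionEquivLeft F κ m) := by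
  have h : evalAt (κ := κ) c =
      (Polynomial.evalRingHom (C c)).comp (optionEquivLeft F κ).toAlgHom.toRingHom := by
    refine MvPolynomial.ringHom_ext (fun a => ?_) (fun o => ?_)
    · simp [optionEquivLeft_C]
    · cases o with
      | none => simp [optionEquivLeft_X_none]
      | some k => simp [optionEquivLeft_X_some]
  rw [h]
  rfl

/-- **A polynomial constraint excludes only finitely many parameters**: over an INFINITE field, if
`m|_{Λ=0} ≠ 0` then `m|_{Λ=c} ≠ 0` for some `c ≠ 0` (MIZUTANI-PROOF-g59 §5, proof of Thm D: "a
minor that is nonzero at λ = 0 is a nonzero polynomial in λ, hence nonzero for all but finitely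
many λ"). [cite: Mizutani1973HironakaGroupSchemes, Remark 2.10 (in-house proof, §5 Thm D)] -/
theorem exists_ne_zero_evalAt_ne_zero [Infinite F] (m : MvPolynomial (Option κ) F)
    (h0 : evalAt 0 m ≠ 0) : ∃ c : F, c ≠ 0 ∧ evalAt c m ≠ 0 := by
  set P := optionEquivLeft F κ m with hP
  have hP0 : P ≠ 0 := by
    intro h
    apply h0
    rw [evalAt_eq_eval_optionEquivLeft, ← hP, h, Polynomial.eval_zero]
  -- the bad parameters inject into the roots of `P`
  have hfin : Set.Finite {c : F | P.IsRoot (C c)} :=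
    (Polynomial.finite_setOf_isRoot hP0).preimage (C_injective κ F).injOn
  have hfin' : Set.Finite ({c : F | P.IsRoot (C c)} ∪ {0}) := hfin.union (Set.finite_singleton 0)
  obtain ⟨c, hc⟩ := hfin'.infinite_compl.nonempty
  simp only [Set.mem_compl_iff, Set.mem_union, Set.mem_setOf_eq, Set.mem_singleton_iff,
    not_or] at hc
  refine ⟨c, hc.2, ?_⟩
  rw [evalAt_eq_eval_optionEquivLeft, ← hP]
  exact hc.1

end Avoid

/-! ## Theorem D -/

section TheoremD

variable {ι κ F : Type*} [Field F] [Fintype ι] [DecidableEq ι] [DecidableEq κ] (e : ι → κ) (q : ℕ)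

/-- **THEOREM D (torus degeneration; MIZUTANI-PROOF-g59 §5).**  Let `F` be an infinite field,
`w ≥ 0` weights, and suppose the torus family of `ω` factors as `(θ_Λ ⊗ θ_Λ) ω = Λ^{m₀} · Ω'`
with `Ω'|_{Λ = 0} = ω₀` (so `ω₀` is the initial form `in_w ω`).  Then `σ_n(ω₀) ≤ σ_n(ω)` for
every `n`.  Proof: a non-zero minor of `HS(ω₀) = HS(Ω')|_{Λ=0}` is a minor of `HS(Ω')` not
killed by `Λ ↦ 0`, hence not killed by `Λ ↦ c` for some `c ≠ 0`; and
`HS(Ω')|_{Λ=c} = c^{-m₀} HS((θ_c ⊗ θ_c)ω)` has the profile of `ω` (torus invariance).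
[cite: Mizutani1973HironakaGroupSchemes, Remark 2.10 (in-house proof, §5 THEOREM D)] -/
theorem profile_le_of_degeneration [Infinite F] (he : Function.Injective e) (w : κ → ℕ) (m₀ : ℕ)
    (ω ω₀ : Rel ι κ F) (Ω' : Rel ι (Option κ) F)
    (hΩ : torus (ePlus e) (X none) (wPlus w) (MvPolynomial.map incl ω) =
      C ((X none : MvPolynomial (Option κ) F) ^ m₀) * Ω')
    (h0 : MvPolynomial.map (evalAt 0) Ω' = ω₀) (n : ℕ) :
    profile e q n ω₀ ≤ profile e q n ω := by
  classical
  by_contra hlt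
  push Not at hlt
  set r := profile e q n ω + 1 with hr
  -- a non-zero `r × r` minor of `HS(ω₀) = HS(Ω')|_{Λ = 0}`
  obtain ⟨rows, cols, hne⟩ := (le_profile_iff e q n r ω₀).mp (by omega)
  have hH0 : hsMatrix e q n ω₀ = (hsMatrix (ePlus e) q n Ω').map (evalAt 0) := by
    rw [← h0, hsMatrix_map_of_compat (ePlus e) e q (evalAt 0) (compat_evalAt e he 0)]
  set m := ((hsMatrix (ePlus e) q n Ω').submatrix rows cols).det with hm
  have hm0 : evalAt 0 m ≠ 0 := by
    rw [hm, RingHom.map_det, RingHom.mapMatrix_apply, ← Matrix.submatrix_map, ← hH0]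
    exact hne
  -- a good parameter `c ≠ 0`
  obtain ⟨c, hc0, hmc⟩ := exists_ne_zero_evalAt_ne_zero m hm0
  -- `HS(Ω')|_{Λ = c}` has a non-zero `r`-minor, and `c^{m₀} · Ω'|_{Λ=c} = (θ_c ⊗ θ_c) ω`
  have hHc : hsMatrix e q n (MvPolynomial.map (evalAt c) Ω') =
      (hsMatrix (ePlus e) q n Ω').map (evalAt c) :=
    hsMatrix_map_of_compat (ePlus e) e q (evalAt c) (compat_evalAt e he c) n Ω'
  have htorus : torus e (C c) w ω = C (C c ^ m₀) * MvPolynomial.map (evalAt c) Ω' := by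
    have hcomp : (MvPolynomial.map (evalAt c)).comp ((torus (ePlus e) (X none) (wPlus w)).comp
        (MvPolynomial.map (incl (κ := κ) (F := F)))) = torus (ι := ι) e (C c) w := by
      refine MvPolynomial.ringHom_ext (fun κ₀ => ?_) (fun i => ?_)
      · simp only [RingHom.comp_apply, map_C, torus_C]
        congr 1
        -- on coefficients: `evalAt c ∘ θ_Λ ∘ incl = θ_c`
        have hc' : ((evalAt c : MvPolynomial (Option κ) F →+* MvPolynomial κ F).comp
            ((torusCoeff (X none : MvPolynomial (Option κ) F) (wPlus w)).toRingHom.comp incl)) =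
            (torusCoeff (C c) w).toRingHom := by
          refine MvPolynomial.ringHom_ext (fun a => ?_) (fun k => ?_)
          · simp
          · simp [torusCoeff_X]
        exact RingHom.congr_fun hc' κ₀
      · simp only [RingHom.comp_apply, map_X, torus_X, map_mul, map_C, map_pow, evalAt_X_none]
        rfl
    have h1 := RingHom.congr_fun hcomp ω
    simp only [RingHom.comp_apply] at h1
    rw [← h1, hΩ, map_mul, map_C, map_pow, evalAt_X_none]
  -- the minor of `HS((θ_c ⊗ θ_c) ω)` is `(c^{m₀})^r` times that of `HS(Ω'|_{Λ=c})`
  have hscaled : ∀ T M, hsMatrix e q n (torus e (C c) w ω) T M =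
      C c ^ m₀ * (RingHom.id _) (hsMatrix e q n (MvPolynomial.map (evalAt c) Ω') T M) * 1 := by
    intro T M
    rw [htorus, hsMatrix_apply, hsOp_C_mul_of_dtaylorCoeff e (by rw [map_pow, dtaylorCoeff_C, map_pow, map_pow]),
      coeff_C_mul, RingHom.id_apply, mul_one, hsMatrix_apply]
  have hdet : ((hsMatrix e q n (torus e (C c) w ω)).submatrix rows cols).det ≠ 0 := by
    rw [det_submatrix_scaled (RingHom.id _) _ _ (fun _ => C c ^ m₀) (fun _ => (1 : MvPolynomial κ F))
      hscaled, RingHom.id_apply]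
    refine mul_ne_zero (mul_ne_zero ?_ ?_) ?_
    · exact Finset.prod_ne_zero_iff.mpr fun _ _ => pow_ne_zero _ (C_ne_zero.mpr hc0)
    · rw [hHc, Matrix.submatrix_map, ← RingHom.mapMatrix_apply, ← RingHom.map_det]
      exact hmc
    · rw [Finset.prod_const_one]; exact one_ne_zero
  have hle : r ≤ profile e q n (torus e (C c) w ω) := (le_profile_iff e q n r _).mpr ⟨rows, cols, hdet⟩
  rw [profile_torus e q hc0] at hle
  omega

end TheoremD

end Summit.ResolutionOfSingularities.KangarooAtlas.Mizutani
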